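import Summits.AtomisticToContinuum.Crystallization.Theses.ReggeStarCoercivity
import Summits.AtomisticToContinuum.Crystallization.Theses.PhononSlackCertificates
import Summits.AtomisticToContinuum.Crystallization.Theorems.ReggeStarCoercivityStarCoercivityShellSuccAbove
import Summits.AtomisticToContinuum.Crystallization.Theorems.ReggeStarCoercivityStarCoercivityNearGoodCount
import Summits.AtomisticToContinuum.Crystallization.Theorems.ReggeStarCoercivityStarCoercivityDefectsGlue
import Summits.AtomisticToContinuum.Crystallization.Theorems.ReggeStarCoercivityStarCoercivityDeletionGlue
import Summits.AtomisticToContinuum.Crystallization.Theorems.ReggeStarCoercivityStarCoercivityTwoShellGoodStarGood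
import Summits.AtomisticToContinuum.Crystallization.Theorems.ReggeStarCoercivityStarCoercivitySeparationRemoval
import Literature.MathematicalPhysics.StatisticalMechanics.LennardJonesClusters

/-!
# `StarCoercivity` (stmt-AtomisticToContinuum-13600) — the transfer line `separation-padding-transfer`, assembled

Route `ReggeStarCoercivity` (sub-problem `Crystallization` of `AtomisticToContinuum`), crux item
`stmt-AtomisticToContinuum-13600`:

  `StarCoercivity = ∃ g > 0, ∃ C, ∀ N, ∀ x : Fin N → ℝ³ injective, N·e_per + g·#Def(x) − C·N^(2/3) ≤ E_LJ(x)`,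

`e_per = ⨅_Q e(Q)` over `PeriodicConfiguration 3`, `#Def(x)` = number of sites whose recentred `6/5`-shell,
rescaled by some `a ∈ [9/10, 11/10]`, is not `1/20`-matched (after a linear isometry) to `fccKissingPattern` or
`hcpKissingPattern`.

This file is the KERNEL-CHECKED REDUCTION of the crux to ONE residual statement, in two equivalent dresses:

* `starCoercivity_of_sepTwoShellGap` — the crux follows from the SEPARATED TWO-SHELL GAP (the line's residual
  stub `stub_separatedTwoShellGap`): `∃ g > 0, ∃ C, ∀ N, ∀ x 1/3-separated,
  N·e_per + g·#{i : ¬ IsTwoShellGood (1/20) (47/50) 1 x i} − C·N^(2/3) ≤ E_LJ(x)`;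
* `starCoercivity_of_coerciveTwoShellGap` — hence from the sibling route's target
  `PhononSlackCertificates.CoerciveTwoShellGap` (item stmt-AtomisticToContinuum-13956; take `δ = 1/3`, `C = 0`).

So 13956 ⇒ 13600 is a theorem of the tree: a proof of `CoerciveTwoShellGap` closes this crux by `modus ponens`
(append `theorem starCoercivity_proof : StarCoercivity := starCoercivity_of_coerciveTwoShellGap h` here).
Both results are CONDITIONAL (the residual is the entire energetic content of the crux: a Lennard-Jones lower
bound sharp to precision `g` at positive defect density, Blanc–Lewin 2015 §2.3 — open in `d = 3`).

PROOF (all ingredients landed as `--supports stmt-AtomisticToContinuum-13600` helper files of this line):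
1. two-shell good ⇒ star good (`stub_twoShellGoodStarGood`, pattern arithmetic with margins
   `1.2824 > 6/5 > 1.05`), so `#Def ≤ #Bad₂` and the separated two-shell gap `(g, C)` gives the separated
   ONE-shell inequality `(g, C)` (`sepStar_of_sepTwoShellGap`);
2. the vacuum competitor (`M³` collinear points at spacing `2`: every shell empty, every site defective, energy
   `≤ 0`; lemmas `separationRemoval_*` of the sibling line's file, reused) turns the separated inequality with
   `g > 0` into `e_per ≤ −g < 0` (`ePer_lt_zero_of_sepStar`);
3. closest-pair deletion removes the separation hypothesis with constants `(min g (−e_per/56), max C 0)`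
   (`stub_deletionGlue`, fed with the defect-count bound `#Def(x) ≤ #Def(x ∘ i₀.succAbove) + 56` =
   `stub_defectsGlue stub_shellSuccAbove stub_nearGoodCount`; the energy side is the tree's
   `exists_le_siteEnergy_of_dist_lt` + `interactionEnergy_eq_succAbove_add_siteEnergy`), and
   `min g (−e_per/56) > 0`.
-/

noncomputable section

open scoped BigOperators Classical
open Literature.MathematicalPhysics.StatisticalMechanics Literature.Geometry.DiscreteGeometry

namespace Summit.AtomisticToContinuum.Crystallization.Theorems.SeparationPaddingTransfer

/-- **Step 1 — two-shell gap ⇒ one-shell inequality on separated configurations, same constants.** If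
`N·e_per + g·#Bad₂(x) − C·N^(2/3) ≤ E_LJ(x)` for every `1/3`-separated `x` and `g ≥ 0`, then the same holds with
the star-defect count `#Def(x) ≤ #Bad₂(x)` (`stub_twoShellGoodStarGood`: two-shell good ⇒ star good) for every
injective `1/3`-separated `x`. -/
theorem sepStar_of_sepTwoShellGap {g C : ℝ} (hg : 0 ≤ g)
    (h : ∀ (N : ℕ) (x : Fin N → EuclideanSpace ℝ (Fin 3)), (∀ i j : Fin N, i ≠ j → (1 / 3 : ℝ) ≤ dist (x i) (x j)) → (N : ℝ) * (⨅ Q : Literature.MathematicalPhysics.StatisticalMechanics.PeriodicConfiguration 3, Q.energyPerParticle Literature.MathematicalPhysics.StatisticalMechanics.lennardJones) + g * (Nat.card {i : Fin N // ¬ Literature.Geometry.DiscreteGeometry.IsTwoShellGood (1 / 20) (47 / 50) 1 x i} : ℝ) - C * (N : ℝ) ^ (2 / 3 : ℝ) ≤ Literature.MathematicalPhysics.StatisticalMechanics.interactionEnergy Literature.MathematicalPhysics.StatisticalMechanics.lennardJones x) :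
    ∀ (N : ℕ) (x : Fin N → EuclideanSpace ℝ (Fin 3)), Function.Injective x → (∀ i j : Fin N, i ≠ j → (1 / 3 : ℝ) ≤ dist (x i) (x j)) → (N : ℝ) * (⨅ Q : Literature.MathematicalPhysics.StatisticalMechanics.PeriodicConfiguration 3, Q.energyPerParticle Literature.MathematicalPhysics.StatisticalMechanics.lennardJones) + g * (Nat.card {i : Fin N // ¬ ∃ a : ℝ, 9 / 10 ≤ a ∧ a ≤ 11 / 10 ∧ (Literature.Geometry.DiscreteGeometry.ShellCloseTo (1 / 20) ((Finset.univ.filter fun j : Fin N => j ≠ i ∧ dist (x i) (x j) ≤ 6 / 5).image fun j => a⁻¹ • (x j - x i)) Literature.Geometry.DiscreteGeometry.fccKissingPattern ∨ Literature.Geometry.DiscreteGeometry.ShellCloseTo (1 / 20) ((Finset.univ.filter fun j : Fin N => j ≠ i ∧ dist (x i) (x j) ≤ 6 / 5).image fun j => a⁻¹ • (x j - x i)) Literature.Geometry.DiscreteGeometry.hcpKissingPattern)} : ℝ) - C * (N : ℝ) ^ (2 / 3 : ℝ) ≤ Literature.MathematicalPhysics.StatisticalMechanics.interactionEnergy Literature.MathematicalPhysics.StatisticalMechanics.lennardJones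 x := by
  intro N x hx hsep
  have hle : (Nat.card {i : Fin N // ¬ ∃ a : ℝ, 9 / 10 ≤ a ∧ a ≤ 11 / 10 ∧ (Literature.Geometry.DiscreteGeometry.ShellCloseTo (1 / 20) ((Finset.univ.filter fun j : Fin N => j ≠ i ∧ dist (x i) (x j) ≤ 6 / 5).image fun j => a⁻¹ • (x j - x i)) Literature.Geometry.DiscreteGeometry.fccKissingPattern ∨ Literature.Geometry.DiscreteGeometry.ShellCloseTo (1 / 20) ((Finset.univ.filter fun j : Fin N => j ≠ i ∧ dist (x i) (x j) ≤ 6 / 5).image fun j => a⁻¹ • (x j - x i)) Literature.Geometry.DiscreteGeometry.hcpKissingPattern)} : ℝ) ≤ (Nat.card {i : Fin N // ¬ Literature.Geometry.DiscreteGeometry.IsTwoShellGood (1 / 20) (47 / 50) 1 x i} : ℝ) := by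
    rw [Nat.cast_le, Nat.card_eq_fintype_card, Nat.card_eq_fintype_card]
    exact Fintype.card_subtype_mono _ _ fun i hi hgood => hi (stub_twoShellGoodStarGood N x i hx hgood)
  have := h N x hsep
  nlinarith [mul_le_mul_of_nonneg_left hle hg]

/-- **Step 2 — the vacuum competitor: a separated star inequality with `g > 0` forces `e_per < 0`.** Test the
inequality on `M³` collinear points at spacing `2` (`i ↦ (2i)·e₀`): the configuration is `2`-separated, every
`6/5`-shell is empty (so every site is star-defective, `separationRemoval_not_good_of_sparse`), and every pair term
is `≤ 0` (`separationRemoval_energy_nonpos_of_sparse`), whence `(e_per + g)·M³ ≤ C·M²` for all `M`, i.e.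
`g ≤ −e_per` (the competitor lemmas are shared with the sibling line's `stub_separationRemoval`). -/
theorem ePer_lt_zero_of_sepStar {g C : ℝ} (hg : 0 < g) (h : ∀ (N : ℕ) (x : Fin N → EuclideanSpace ℝ (Fin 3)), Function.Injective x → (∀ i j : Fin N, i ≠ j → (1 / 3 : ℝ) ≤ dist (x i) (x j)) → (N : ℝ) * (⨅ Q : Literature.MathematicalPhysics.StatisticalMechanics.PeriodicConfiguration 3, Q.energyPerParticle Literature.MathematicalPhysics.StatisticalMechanics.lennardJones) + g * (Nat.card {i : Fin N // ¬ ∃ a : ℝ, 9 / 10 ≤ a ∧ a ≤ 11 / 10 ∧ (Literature.Geometry.DiscreteGeometry.ShellCloseTo (1 / 20) ((Finset.univ.filter fun j : Fin N => j ≠ i ∧ dist (x i) (x j) ≤ 6 / 5).image fun j => a⁻¹ • (x j - x i)) Literature.Geometry.DiscreteGeometry.fccKissingPattern ∨ Literature.Geometry.DiscreteGeometry.ShellCloseTo (1 / 20) ((Finset.univ.filter fun j : Fin N => j ≠ i ∧ dist (x i) (x j) ≤ 6 / 5).image fun j => a⁻¹ • (x j - x i)) Literature.Geometry.DiscreteGeometry.hcpKissingPattern)}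 : ℝ) - C * (N : ℝ) ^ (2 / 3 : ℝ) ≤ Literature.MathematicalPhysics.StatisticalMechanics.interactionEnergy Literature.MathematicalPhysics.StatisticalMechanics.lennardJones x) : (⨅ Q : Literature.MathematicalPhysics.StatisticalMechanics.PeriodicConfiguration 3, Q.energyPerParticle Literature.MathematicalPhysics.StatisticalMechanics.lennardJones) < 0 := by
  -- it suffices to show `g ≤ -e_per`; the collinear competitor is the one of the sibling file
  -- `ReggeStarCoercivityStarCoercivitySeparationRemoval` (`separationRemoval_*` lemmas, line elastic-tier-overlap-split)
  suffices hle : g ≤ -(⨅ Q : Literature.MathematicalPhysics.StatisticalMechanics.PeriodicConfiguration 3, Q.energyPerParticle Literature.MathematicalPhysics.StatisticalMechanics.lennardJones) by linarith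
  by_contra hlt
  push Not at hlt
  set e : ℝ := (⨅ Q : Literature.MathematicalPhysics.StatisticalMechanics.PeriodicConfiguration 3, Q.energyPerParticle Literature.MathematicalPhysics.StatisticalMechanics.lennardJones) with he_def
  set c : ℝ := e + g with hc_def
  have hc : 0 < c := by rw [hc_def]; linarith
  obtain ⟨M, hM⟩ := exists_nat_gt (|C| / c)
  set L : Fin (M ^ 3) → EuclideanSpace ℝ (Fin 3) :=
    fun i => ((2 : ℝ) * ((i : ℕ) : ℝ)) • EuclideanSpace.single (0 : Fin 3) (1 : ℝ) with hL
  have hLd : ∀ i j : Fin (M ^ 3), i ≠ j → 2 ≤ dist (L i) (L j) := fun i j hij =>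
    separationRemoval_two_le_dist_line (e := EuclideanSpace.single (0 : Fin 3) (1 : ℝ)) (by simp) hij
  have hinj : Function.Injective L := fun i j hij => by
    by_contra hne
    have h2 := hLd i j hne
    rw [hij, dist_self] at h2
    linarith
  have key := h (M ^ 3) L hinj (fun i j hij => by linarith [hLd i j hij])
  rw [Nat.card_congr (Equiv.subtypeUnivEquiv
    (separationRemoval_not_good_of_sparse (x := L) fun i j hij => by linarith [hLd i j hij])),
    Nat.card_eq_fintype_card, Fintype.card_fin] at key
  have hE := separationRemoval_energy_nonpos_of_sparse (x := L) (fun i j hij => by linarith [hLd i j hij])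
  push_cast at key
  rw [separationRemoval_cube_rpow_two_thirds] at key
  have hMpos : (0 : ℝ) < M := lt_of_le_of_lt (by positivity) hM
  have h1 : c * (M : ℝ) ^ 3 ≤ C * (M : ℝ) ^ 2 := by rw [hc_def]; nlinarith
  have h2 : c * (M : ℝ) ≤ C := by
    have hM2 : (0 : ℝ) < (M : ℝ) ^ 2 := by positivity
    have : c * (M : ℝ) * (M : ℝ) ^ 2 ≤ C * (M : ℝ) ^ 2 := by nlinarith
    exact le_of_mul_le_mul_right this hM2
  have h3 : |C| < c * (M : ℝ) := by rwa [div_lt_iff₀ hc, mul_comm] at hM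
  linarith [le_abs_self C]

/-- **`StarCoercivity` from the separated two-shell gap** (the residual stub of the line
`separation-padding-transfer`, = `CoerciveTwoShellGap` at `δ = 1/3` with a `C·N^(2/3)` allowance): Step 1 gives the
separated one-shell inequality `(g, C)`, Step 2 gives `e_per < 0`, and the closest-pair deletion
`stub_deletionGlue (stub_defectsGlue stub_shellSuccAbove stub_nearGoodCount)` yields the crux inequality for
ALL injective configurations with the positive constant `min g (−e_per/56)` and slack `max C 0`. CONDITIONAL on
its hypothesis (open). -/
theorem starCoercivity_of_sepTwoShellGap (h : ∃ g : ℝ, 0 < g ∧ ∃ C : ℝ, ∀ (N : ℕ) (x : Fin N → EuclideanSpace ℝ (Fin 3)), (∀ i j : Fin N, i ≠ j → (1 / 3 : ℝ) ≤ dist (x i) (x j)) → (N : ℝ) * (⨅ Q : Literature.MathematicalPhysics.StatisticalMechanics.PeriodicConfiguration 3, Q.energyPerParticle Literature.MathematicalPhysics.StatisticalMechanics.lennardJones) + g * (Nat.card {i : Fin N // ¬ Literature.Geometry.DiscreteGeometry.IsTwoShellGood (1 / 20) (47 / 50) 1 x i} : ℝ) - C * (N : ℝ) ^ (2 / 3 :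 ℝ) ≤ Literature.MathematicalPhysics.StatisticalMechanics.interactionEnergy Literature.MathematicalPhysics.StatisticalMechanics.lennardJones x) :
    Summit.AtomisticToContinuum.Crystallization.Theses.ReggeStarCoercivity.StarCoercivity := by
  obtain ⟨g, hg, C, hgap⟩ := h
  have hR1 := sepStar_of_sepTwoShellGap hg.le hgap
  have he := ePer_lt_zero_of_sepStar hg hR1
  refine ⟨min g (-(⨅ Q : Literature.MathematicalPhysics.StatisticalMechanics.PeriodicConfiguration 3, Q.energyPerParticle Literature.MathematicalPhysics.StatisticalMechanics.lennardJones) / 56), lt_min hg (by linarith), max C 0, ?_⟩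
  exact stub_deletionGlue (stub_defectsGlue stub_shellSuccAbove stub_nearGoodCount) g C hg he hR1

/-- **13956 ⇒ 13600: `StarCoercivity` from `PhononSlackCertificates.CoerciveTwoShellGap`** (the sibling route's
target, item stmt-AtomisticToContinuum-13956): instantiate it at `δ = 1/3` (slack `C = 0`) and apply
`starCoercivity_of_sepTwoShellGap`. CONDITIONAL on `CoerciveTwoShellGap` (open). -/
theorem starCoercivity_of_coerciveTwoShellGap
    (h : Summit.AtomisticToContinuum.Crystallization.Theses.PhononSlackCertificates.CoerciveTwoShellGap) :
    Summit.AtomisticToContinuum.Crystallization.Theses.ReggeStarCoercivity.StarCoercivity := by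
  obtain ⟨g, hg, hh⟩ := h (1 / 3) (by norm_num)
  refine starCoercivity_of_sepTwoShellGap ⟨g, hg, 0, fun N x hs => ?_⟩
  have := hh N x hs
  simp only [zero_mul, sub_zero]
  exact this

/-- Registered-stub form of `starCoercivity_of_coerciveTwoShellGap` (stub `stub_twoShellTransfer` of crux
stmt-AtomisticToContinuum-13600: 13956 ⇒ 13600). -/
theorem stub_twoShellTransfer : Summit.AtomisticToContinuum.Crystallization.Theses.PhononSlackCertificates.CoerciveTwoShellGap → Summit.AtomisticToContinuum.Crystallization.Theses.ReggeStarCoercivity.StarCoercivity :=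
  starCoercivity_of_coerciveTwoShellGap

end Summit.AtomisticToContinuum.Crystallization.Theorems.SeparationPaddingTransfer

end
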